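import Summits.HodgeConjecture.HodgeCM.Automorphic.WeilThetaModelHeisenbergPresentation_1

/-! PORT of `HodgeCM/Automorphic/WeilThetaModelHeisenbergPresentation.lean` (HodgeCMPerL run 82) — part 2: continuation of `Summits.HodgeConjecture.HodgeCM.Automorphic.WeilThetaModelHeisenbergPresentation_1` (split at a top-level declaration boundary by port_pkg.py; scope re-opened below; declarations unchanged). -/

-- port_pkg: scope re-opened for this part (file-level context, then the namespace/section stack open at the cut)
set_option autoImplicit false
noncomputable section
open scoped Pointwise RealInnerProductSpace SchwartzMap
namespace HodgeCM
namespace SchwartzWeil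
namespace Heis
variable {V : Type*} [NormedAddCommGroup V] [InnerProductSpace ℝ V] (m : ℤ) (hm : m ≠ 0)
/-- `ψ̄ ∘ Φ = L`, the lift of the ping-pong pair. -/
theorem psActionQ_comp_ΦQ : (psActionQ (V := V) m hm).comp ΦQ = FreeGroup.lift (pairGen m hm) := by
  refine FreeGroup.ext_hom _ _ fun b => ?_
  cases b
  · simp only [MonoidHom.comp_apply, ΦQ, QuotientGroup.coe_mk', toPair_of_false, psActionQ_mk, map_mul,
      map_inv, psAction_weyl, psAction_unip, FreeGroup.lift_apply_of, pairGen_false]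
  · simp only [MonoidHom.comp_apply, ΦQ, QuotientGroup.coe_mk', toPair_of_true, psActionQ_mk, psAction_unip,
      FreeGroup.lift_apply_of, pairGen_true]

/-- (Ported verbatim from the HodgeCMPerL package; no docstring in the source.) -/
theorem psActionQ_ΦQ (v : FreeGroup Bool) : psActionQ (V := V) m hm (ΦQ v) = FreeGroup.lift (pairGen m hm) v := by
  rw [← psActionQ_comp_ΦQ m hm, MonoidHom.comp_apply]

/-- **`ψ̄` is injective**: `Q ≅ ⟨S_m, U⟩`. -/
theorem injective_psActionQ [Nontrivial V] : Function.Injective (psActionQ (V := V) m hm) := by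
  rw [injective_iff_map_eq_one]
  intro q hq
  induction q using QuotientGroup.induction_on with
  | H w =>
    obtain ⟨ε, v, hw⟩ := exists_normalForm w
    rw [hw, map_mul, map_zpow, psActionQ_sQ, psActionQ_ΦQ, mul_eq_one_iff_eq_inv, ← map_inv] at hq
    -- `S_m^ε = L(v⁻¹)`; fourth power: `L(v⁻¹)^4 = 1`, so `v = 1` (free groups are torsion-free)
    have h4 : FreeGroup.lift (pairGen (V := V) m hm) (v⁻¹ ^ 4) = 1 := by
      have h4' : weylAut (V := V) m hm ^ ((4 : ℕ) : ℤ) = 1 := by rw [zpow_natCast]; exact weylAut_pow_four m hm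
      rw [map_pow, ← hq, ← zpow_natCast, ← zpow_mul, mul_comm, zpow_mul, h4', one_zpow]
    have h5 : v⁻¹ ^ 4 = 1 := injective_lift_pairGen m hm (by rw [h4, map_one])
    have hv : v = 1 := inv_eq_one.mp ((pow_eq_one_iff_left (by norm_num)).mp h5)
    subst hv
    rw [inv_one, map_one] at hq
    obtain ⟨q, hq'⟩ := four_dvd_of_weylAut_zpow_eq_one m hm hq
    rw [hw, map_one, mul_one, hq', zpow_mul, sQ_zpow_four, one_zpow]

/-- **MAIN THEOREM.  `ker ψ = ⟪σ⁴, [σ², u]⟫`:** the subgroup `⟨S_m, U⟩` of `Aut (Heis V)` (equivalently of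
`Sp(V ⊕ V)`) generated by `S_m = (0 m; -m⁻¹ 0)` and `U = (1 0; 2 1)` is presented by `S_m⁴ = 1`, `[S_m², U] = 1`,
for every `m ≠ 0` and every nontrivial real inner product space `V`. -/
theorem ker_psAction_eq_psRelations [Nontrivial V] : (psAction (V := V) m hm).ker = psRelations := by
  refine le_antisymm ?_ (psRelations_le_ker_psAction' m hm)
  intro w hw
  rw [MonoidHom.mem_ker] at hw
  have : (QuotientGroup.mk w : PsQuot) = 1 :=
    injective_psActionQ (V := V) m hm (by rw [psActionQ_mk, hw, map_one])
  exact (QuotientGroup.eq_one_iff w).mp this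

/-- (Ported verbatim from the HodgeCMPerL package; no docstring in the source.) -/
theorem psAction_eq_one_iff [Nontrivial V] (w : FreeGroup PsGen) : psAction (V := V) m hm w = 1 ↔ w ∈ psRelations := by
  rw [← ker_psAction_eq_psRelations (V := V) m hm, MonoidHom.mem_ker]

/-- Two words define the same element of `⟨S_m, U⟩` iff they are congruent modulo `⟪σ⁴, [σ², u]⟫`. -/
theorem psAction_eq_iff [Nontrivial V] (w₁ w₂ : FreeGroup PsGen) :
    psAction (V := V) m hm w₁ = psAction m hm w₂ ↔ (QuotientGroup.mk w₁ : PsQuot) = QuotientGroup.mk w₂ := by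
  rw [QuotientGroup.eq, ← psAction_eq_one_iff (V := V) m hm, map_mul, map_inv, inv_mul_eq_one, eq_comm]

/-- `Q = F⟨σ,u⟩ / ⟪σ⁴, [σ², u]⟫ ≃* ⟨S_m, U⟩` (the range of `ψ`). -/
def psQuotEquivRange [Nontrivial V] : PsQuot ≃* (psAction (V := V) m hm).range :=
  (QuotientGroup.quotientMulEquivOfEq (ker_psAction_eq_psRelations m hm).symm).trans
    (QuotientGroup.quotientKerEquivRange (psAction m hm))

end Heis

/-! ## 5. No cocycle on `⟨S_m, U⟩`: every relation holds on the nose in `U(𝓢(V, ℂ))` -/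

section Model

variable (V : Type) [NormedAddCommGroup V] [InnerProductSpace ℝ V] [FiniteDimensional ℝ V] [MeasurableSpace V]
  [BorelSpace V] [Nontrivial V] (m : ℤ) (hm : m ≠ 0)

/-- **`ker ψ ≤ ker π`.**  A word in `𝓕, T_m` whose matrix in `⟨S_m, U⟩` is the identity IS the identity
operator of `𝓢(V, ℂ)` — not merely a scalar: the section `S_m ↦ 𝓕`, `U ↦ T_m` trivialises the metaplectic
cocycle on `⟨S_m, U⟩`. -/
theorem psRep_eq_one_of_psAction_eq_one {w : FreeGroup PsGen} (hw : Heis.psAction (V := V) m hm w = 1) :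
    psRep V m w = 1 :=
  psRelations_le_ker_psRep V m ((Heis.psAction_eq_one_iff m hm w).mp hw)

/-- (Ported verbatim from the HodgeCMPerL package; no docstring in the source.) -/
theorem ker_psAction_le_ker_psRep : (Heis.psAction (V := V) m hm).ker ≤ (psRep V m).ker := fun _ hw =>
  psRep_eq_one_of_psAction_eq_one V m hm hw

/-- `π` is constant on the fibres of `ψ`: the operator attached to a word depends only on its matrix. -/
theorem psRep_eq_of_psAction_eq {w₁ w₂ : FreeGroup PsGen}
    (h : Heis.psAction (V := V) m hm w₁ = Heis.psAction m hm w₂) : psRep V m w₁ = psRep V m w₂ := by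
  rw [← inv_mul_eq_one, ← map_inv, ← map_mul]
  exact psRep_eq_one_of_psAction_eq_one V m hm (by rw [map_mul, map_inv, h, inv_mul_cancel])

/-- The model `repP` of #12 factors through `Heis V ⋊ ⟨S_m, U⟩`: on the `F⟨σ,u⟩`-factor it only depends on the
matrix `ψ w`. -/
theorem repP_inr_eq_of_psAction_eq {w₁ w₂ : FreeGroup PsGen}
    (h : Heis.psAction (V := V) m hm w₁ = Heis.psAction m hm w₂) :
    repP V m hm (SemidirectProduct.inr w₁) = repP V m hm (SemidirectProduct.inr w₂) := by
  rw [repP_def, repSD_inr, repSD_inr]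
  exact psRep_eq_of_psAction_eq V m hm h

/-- **`π` descends to `⟨S_m, U⟩`:** a genuine representation `π♭ : ⟨S_m, U⟩ → U(𝓢(V, ℂ))` with
`π♭ ∘ ψ = π` (`psRepRange_apply_psAction`). -/
def psRepRange : (Heis.psAction (V := V) m hm).range →* (𝓢(V, ℂ) →L[ℂ] 𝓢(V, ℂ))ˣ :=
  (QuotientGroup.lift (Heis.psAction (V := V) m hm).ker (psRep V m) (ker_psAction_le_ker_psRep V m hm)).comp
    (QuotientGroup.quotientKerEquivRange (Heis.psAction (V := V) m hm)).symm.toMonoidHom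

/-- (Ported verbatim from the HodgeCMPerL package; no docstring in the source.) -/
theorem psRepRange_apply_psAction (w : FreeGroup PsGen) :
    psRepRange V m hm ⟨Heis.psAction m hm w, w, rfl⟩ = psRep V m w := by
  have h1 : (QuotientGroup.quotientKerEquivRange (Heis.psAction (V := V) m hm)).symm
      ⟨Heis.psAction m hm w, w, rfl⟩ = QuotientGroup.mk w := by
    rw [MulEquiv.symm_apply_eq]
    rfl
  rw [psRepRange, MonoidHom.comp_apply, MulEquiv.coe_toMonoidHom, h1, QuotientGroup.lift_mk]

end Model

end SchwartzWeil
end HodgeCM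

-- port_pkg: scope closed for this part
end
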